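import Literature.NumberTheory.EllipticCurves.ModularCurveManinSemistableCoprimeFormProofs
import Literature.NumberTheory.DiophantineGeometry.LocalReductionHasMultiplicativeReductionAtProofs
import Literature.NumberTheory.DiophantineGeometry.LocalReductionMinimalityProofs
import Literature.NumberTheory.DiophantineGeometry.LocalReductionFiniteBadPlacesProofs
import Literature.NumberTheory.EllipticCurves.NeronLocalHeightCompletion
import Literature.NumberTheory.EllipticCurves.RootNumberProofs
import Literature.NumberTheory.EllipticCurves.QuadraticTwist
import Summits.BirchSwinnertonDyer.Rank1Residual.EisensteinPrimes
import HarnessLib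

/-!
# The ramified quadratic twist `V^{(±p)}` of a `p`-semistable globally minimal curve is `p`-minimal; hence `ord_p u = 0` for the change of variables to a minimal model (cell `b2b-bsdres`, seat additive-p4, line V9)

HONEST FRAMING (cell `b2b-bsdres`, run/shared/lean/b2b/bsd-rank1-residual/, verbatim in every
file): the goal of the cell is to DELETE the COMBINATION-SHAPED residual classes of the
Birch–Swinnerton-Dyer formula for ALL analytic-rank `≤ 1` elliptic curves over `ℚ` — "full BSD
formula for every rank `≤ 1` curve in class `C`" assembled STRICTLY from published theorems — so
that the rank-`≤ 1` remainder becomes exactly the CONSTRUCTION-SHAPED classes, which are TYPED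
(missing-input `Prop`s), NOT attempted. This is not "finishing BSD". The additive sub-cell (seats
additive-p1…p4) is a RESEARCH ROUTE on the construction-shaped classes X3/X4; no claim beyond the
stated classes; the label of X3 is UNCHANGED.

Theorems only (no definition, no named fact). The non-archimedean content of Pal 2012, Prop. 2.5
at the twisting prime — "`u_p = 1` if `λ_{v_p}(E) = min(3v(c₄), 2v(c₆), v(Δ)) < 6`" — in the case the
line V9 needs, PROVED from the tree's minimality criteria (Silverman *AEC* VII.1 Remark 1.1:
`isMinimalAt_of_lt_valuation_Δ`, `isMinimalAt_of_lt_valuation_c₄`) and Prop. VII.1.3 (b)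
(`exists_algebraMap_eq_u_of_isMinimal`): for `V/ℚ` globally minimal, good or multiplicative at an
odd prime `p`, and `d = ±p`,

* `isIntegralAt_quadraticTwist_intCast` — the tree's twisted model `V^{(d)}` (`quadraticTwist`:
  `a₂ = d b₂/4`, `a₄ = d² b₄/2`, `a₆ = d³ b₆/4`) is `p`-integral (`2 ∈ ℤ_pˣ`);
* `isMinimalAt_quadraticTwist_pm_p` — it is `p`-MINIMAL: `v_p(Δ(V^{(±p)})) = 6 < 12` if `V` is good
  at `p` (`p ∤ Δ(V)`), `v_p(c₄(V^{(±p)})) = 2 < 4` if `V` is multiplicative at `p` (`p ∤ c₄(V)`,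
  `not_dvd_Δ_or_not_dvd_c₄_of_isSemistableAt`);
* `padicValRat_u_eq_zero_of_twist_pm_p` — consequently, for ANY change of variables `C` over `ℚ`
  with `C • V^{(±p)} = W` globally minimal, **`ord_p u(C) = 0`** (two `p`-minimal equations differ
  by a `p`-unit `u`).
This discharges the hypothesis `ord_p u(C) = 0` of the odd V9 assembly
(`Additive/X3RankZeroSemistableTwistOdd.lean`), where `|u(C)|` is the explicit scaling factor of the
tree's proved form of Pal's period formula `Ω(W)·√p = |u(C)|·c_∞(W)·|Ω⁻(V)|`
(`realPeriodRat_mul_sqrt_of_twist_of_neg`, file `ImaginaryPeriod`).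

References: Pal 2012 [Pal2012] Prop. 2.5, Cor. 2.6; Silverman *AEC* [SilvermanAEC2009] VII.1
Remark 1.1, Prop. VII.1.3 (b), VII.5 Prop. 5.1.
-/

noncomputable section

open scoped Classical

open WeierstrassCurve IsDedekindDomain Rat.HeightOneSpectrum
  Literature.NumberTheory.EllipticCurves Literature.NumberTheory.EllipticCurves.Rank1Residual

namespace Summit.BirchSwinnertonDyer.Rank1Residual.Additive

section Minimality

variable (p : ℕ) [hp : Fact p.Prime]

/-- The rational prime below the place `primesEquiv.symm p` of `ℤ` is `p`. -/
private theorem natGenerator_place :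
    natGenerator ((primesEquiv (R := ℤ)).symm ⟨p, hp.out⟩) = p :=
  Literature.NumberTheory.EllipticCurves.Rat.natGenerator_primesEquiv_symm ⟨p, hp.out⟩

/-- `v_p(±p) = exp(−1)`: `±p` is a uniformiser at the place below `p`. -/
theorem valuation_pm_p {d : ℤ} (hd : d = p ∨ d = -p) :
    ((primesEquiv (R := ℤ)).symm ⟨p, hp.out⟩).valuation ℚ (d : ℚ) = WithZero.exp (-1 : ℤ) := by
  set v : HeightOneSpectrum ℤ := (primesEquiv (R := ℤ)).symm ⟨p, hp.out⟩ with hv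
  have h := valuation_natGenerator_int v
  rw [natGenerator_place p] at h
  rcases hd with rfl | rfl
  · exact_mod_cast h
  · push_cast
    rw [Valuation.map_neg]
    exact h

/-- **The twisted model `V^{(d)}` (`d ∈ ℤ`) is `p`-integral** for a globally minimal `V` and odd `p`:
its coefficients are `0, d·b₂/4, 0, d²·b₄/2, d³·b₆/4` with `bᵢ(V) ∈ ℤ` and `2 ∈ ℤ_pˣ`
(Silverman *AEC* VII.1). -/
theorem isIntegralAt_quadraticTwist_intCast (hp2 : p ≠ 2) (V : WeierstrassCurve ℚ)
    [V.IsGloballyMinimal] (d : ℤ) :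
    (V.quadraticTwist (d : ℚ)).IsIntegralAt ((primesEquiv (R := ℤ)).symm ⟨p, hp.out⟩) := by
  set v : HeightOneSpectrum ℤ := (primesEquiv (R := ℤ)).symm ⟨p, hp.out⟩ with hv
  have hgen : natGenerator v = p := natGenerator_place p
  -- valuations of the ingredients
  have hdle : v.valuation ℚ (d : ℚ) ≤ 1 := v.valuation_le_one (K := ℚ) d
  have h2 : v.valuation ℚ ((2 : ℤ) : ℚ) = 1 := by
    rw [Literature.NumberTheory.EllipticCurves.Rat.valuation_intCast_eq_one_iff, hgen]
    intro h
    exact hp2 ((Nat.prime_dvd_prime_iff_eq hp.out Nat.prime_two).mp (by exact_mod_cast h))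
  have h4 : v.valuation ℚ ((4 : ℤ) : ℚ) = 1 := by
    rw [show ((4 : ℤ) : ℚ) = ((2 : ℤ) : ℚ) * ((2 : ℤ) : ℚ) by norm_num, map_mul, h2, one_mul]
  have hb₂ : v.valuation ℚ V.b₂ ≤ 1 := by
    rw [← map_integralModelInt V, map_b₂, eq_intCast]
    exact v.valuation_le_one (K := ℚ) _
  have hb₄ : v.valuation ℚ V.b₄ ≤ 1 := by
    rw [← map_integralModelInt V, map_b₄, eq_intCast]
    exact v.valuation_le_one (K := ℚ) _
  have hb₆ : v.valuation ℚ V.b₆ ≤ 1 := by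
    rw [← map_integralModelInt V, map_b₆, eq_intCast]
    exact v.valuation_le_one (K := ℚ) _
  refine isIntegralAt_of_valuation_le_one v (V.quadraticTwist (d : ℚ)) ?_ ?_ ?_ ?_ ?_
  · rw [quadraticTwist_a₁, map_zero]; exact zero_le
  · rw [quadraticTwist_a₂, map_div₀, map_mul, show (4 : ℚ) = ((4 : ℤ) : ℚ) by norm_num, h4, div_one]
    exact mul_le_one' hdle hb₂
  · rw [quadraticTwist_a₃, map_zero]; exact zero_le
  · rw [quadraticTwist_a₄, map_div₀, map_mul, map_pow, show (2 : ℚ) = ((2 : ℤ) : ℚ) by norm_num,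
      h2, div_one]
    exact mul_le_one' (pow_le_one' hdle 2) hb₄
  · rw [quadraticTwist_a₆, map_div₀, map_mul, map_pow, show (4 : ℚ) = ((4 : ℤ) : ℚ) by norm_num,
      h4, div_one]
    exact mul_le_one' (pow_le_one' hdle 3) hb₆

/-- **The twisted model `V^{(±p)}` is `p`-MINIMAL when `V` is globally minimal and semistable at
`p`** (`p` odd): if `V` is good at `p` then `v_p(Δ(V^{(±p)})) = v_p(p⁶ Δ(V)) = 6 < 12`; if `V` is
multiplicative at `p` then `v_p(c₄(V^{(±p)})) = v_p(p² c₄(V)) = 2 < 4` (Silverman *AEC* VII.1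
Remark 1.1; tree criteria `isMinimalAt_of_lt_valuation_Δ` / `isMinimalAt_of_lt_valuation_c₄`). This
is Pal 2012 Prop. 2.5's `u_p = 1` (`λ_{v_p}(V) = min(3v(c₄), 2v(c₆), v(Δ)) = 0 < 6`). -/
theorem isMinimalAt_quadraticTwist_pm_p (hp2 : p ≠ 2) (V : WeierstrassCurve ℚ) [V.IsElliptic]
    [V.IsGloballyMinimal] (hV : Good V p ∨ Mult V p) {d : ℤ} (hd : d = p ∨ d = -p) :
    (V.quadraticTwist (d : ℚ)).IsMinimalAt ((primesEquiv (R := ℤ)).symm ⟨p, hp.out⟩) := by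
  set v : HeightOneSpectrum ℤ := (primesEquiv (R := ℤ)).symm ⟨p, hp.out⟩ with hv
  have hgen : natGenerator v = p := natGenerator_place p
  have hint := isIntegralAt_quadraticTwist_intCast p hp2 V d
  have hdval : v.valuation ℚ (d : ℚ) = WithZero.exp (-1 : ℤ) := valuation_pm_p p hd
  -- `p ∤ Δ(V_ℤ)` or `p ∤ c₄(V_ℤ)`
  have hsemi : ¬ ((p : ℤ) ∣ (integralModelInt V).Δ) ∨ ¬ ((p : ℤ) ∣ (integralModelInt V).c₄) := by
    rcases hV with hgood | hmult
    · exact Or.inl (EisensteinPrimes.not_dvd_disc_of_good V p hgood)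
    · have hmultAt : V.HasMultiplicativeReductionAt v :=
        (V.hasMultiplicativeReductionAtPrime_iff_hasMultiplicativeReductionAt_holds ⟨p, hp.out⟩).mp hmult
      have h := not_dvd_Δ_or_not_dvd_c₄_of_isSemistableAt V (Or.inr hmultAt)
      rwa [hgen] at h
  rcases hsemi with hΔ | hc₄
  · -- good case: `v(Δ(V^{(d)})) = exp(-6) > exp(-12)`
    refine isMinimalAt_of_lt_valuation_Δ_holds (v := v) (W := V.quadraticTwist (d : ℚ)) hint ?_
    have hΔV : v.valuation ℚ V.Δ = 1 := by
      rw [← cast_integralModelInt_Δ V,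
        Literature.NumberTheory.EllipticCurves.Rat.valuation_intCast_eq_one_iff, hgen]
      exact hΔ
    rw [quadraticTwist_Δ, map_mul, map_pow, hdval, hΔV, mul_one, ← WithZero.exp_nsmul]
    exact WithZero.exp_lt_exp.mpr (by norm_num)
  · -- multiplicative case: `v(c₄(V^{(d)})) = exp(-2) > exp(-4)`
    refine isMinimalAt_of_lt_valuation_c₄ hint ?_
    have hcV : v.valuation ℚ V.c₄ = 1 := by
      rw [← cast_integralModelInt_c₄ V,
        Literature.NumberTheory.EllipticCurves.Rat.valuation_intCast_eq_one_iff, hgen]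
      exact hc₄
    rw [quadraticTwist_c₄, map_mul, map_pow, hdval, hcV, mul_one, ← WithZero.exp_nsmul]
    exact WithZero.exp_lt_exp.mpr (by norm_num)

/-- **`ord_p u(C) = 0`** for a change of variables `C` over `ℚ` from the twisted model `V^{(±p)}`
(`V` globally minimal, good or multiplicative at the odd prime `p`) to a globally minimal `W`: both
equations are `p`-minimal (`isMinimalAt_quadraticTwist_pm_p`, `IsGloballyMinimal.isMinimalAt_int`),
so `u ∈ ℤ_pˣ` (Silverman *AEC* VII.1 Prop. 1.3 (b); tree `exists_algebraMap_eq_u_of_isMinimal`).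
Pal 2012, Prop. 2.5: `u_p = 1`. -/
theorem padicValRat_u_eq_zero_of_twist_pm_p (hp2 : p ≠ 2) (V W : WeierstrassCurve ℚ) [V.IsElliptic]
    [V.IsGloballyMinimal] [W.IsGloballyMinimal] (hV : Good V p ∨ Mult V p) {d : ℤ}
    (hd : d = p ∨ d = -p) (C : VariableChange ℚ) (hC : C • V.quadraticTwist (d : ℚ) = W) :
    padicValRat p (C.u : ℚ) = 0 := by
  set v : HeightOneSpectrum ℤ := (primesEquiv (R := ℤ)).symm ⟨p, hp.out⟩ with hv
  have hgen : natGenerator v = p := natGenerator_place p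
  set X : WeierstrassCurve ℚ := V.quadraticTwist (d : ℚ) with hX
  have hd0 : (d : ℚ) ≠ 0 := by
    rcases hd with rfl | rfl <;> push_cast <;> simp [hp.out.ne_zero]
  haveI : X.IsElliptic := V.isElliptic_quadraticTwist hd0
  -- both `X` and `W = C • X` are minimal over `O_v`
  haveI hXmin : IsMinimal (v.adicCompletionIntegers ℚ) (X.baseChange (v.adicCompletion ℚ)) :=
    isMinimalAt_quadraticTwist_pm_p p hp2 V hV hd
  haveI : IsMinimal (v.adicCompletionIntegers ℚ)
      ((C.baseChange (v.adicCompletion ℚ)) • (X.baseChange (v.adicCompletion ℚ))) := by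
    rw [VariableChange.baseChange, baseChange, map_variableChange, hC]
    exact IsGloballyMinimal.isMinimalAt_int W v
  have hΔ : (X.baseChange (v.adicCompletion ℚ)).Δ ≠ 0 := by
    rw [baseChange, map_Δ]
    exact (map_ne_zero _).mpr (isUnit_Δ X).ne_zero
  obtain ⟨⟨a, ha⟩, ⟨b, hb⟩⟩ := exists_algebraMap_eq_u_of_isMinimal (v.adicCompletionIntegers ℚ)
    (X.baseChange (v.adicCompletion ℚ)) (C.baseChange (v.adicCompletion ℚ)) hΔ
  rw [VariableChange.baseChange] at ha hb
  rw [VariableChange.map_u, Units.coe_map, MonoidHom.coe_coe] at ha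
  rw [VariableChange.map_u, Units.coe_map_inv, MonoidHom.coe_coe] at hb
  have hu1 : v.valuation ℚ (C.u : ℚ) ≤ 1 := by
    have h := a.2
    rw [HeightOneSpectrum.mem_adicCompletionIntegers, ← ValuationSubring.algebraMap_apply, ha] at h
    rwa [← HeightOneSpectrum.valuedAdicCompletion_eq_valuation']
  have hu2 : v.valuation ℚ (↑C.u⁻¹ : ℚ) ≤ 1 := by
    have h := b.2
    rw [HeightOneSpectrum.mem_adicCompletionIntegers, ← ValuationSubring.algebraMap_apply, hb] at h
    rwa [← HeightOneSpectrum.valuedAdicCompletion_eq_valuation']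
  have hu0 : (C.u : ℚ) ≠ 0 := C.u.ne_zero
  have hval : v.valuation ℚ (C.u : ℚ) = 1 := by
    refine le_antisymm hu1 ?_
    rw [Units.val_inv_eq_inv_val, map_inv₀] at hu2
    have hpos : 0 < v.valuation ℚ (C.u : ℚ) := by
      rw [Valuation.pos_iff]
      exact hu0
    exact (inv_le_one₀ hpos).mp hu2
  -- translate to `padicValRat`
  have h := valuation_eq_exp_neg_padicValRat v hu0
  rw [hval, hgen] at h
  have h' : WithZero.exp (0 : ℤ) = WithZero.exp (-padicValRat p (C.u : ℚ)) := by
    rw [WithZero.exp_zero]; exact h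
  have := WithZero.exp_injective h'
  omega

end Minimality

end Summit.BirchSwinnertonDyer.Rank1Residual.Additive

end
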